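import Summits.ResolutionOfSingularities.ResolutionOfSingularities.Theorems.NearPointCutKernels
import Summits.ResolutionOfSingularities.ResolutionOfSingularities.Theorems.MaxContactCutSurfaceShadow
import Summits.ResolutionOfSingularities.ResolutionOfSingularities.Theorems.MaxContactCutCornerTowers
import HarnessLib

/-!
# MaxContactCutNearPointCut — the decomp-res node «NearPointCut» v3 BY NAME on the host route `MaxContactCut`
(lens-4 g14, sha256 f6cc5d14e40b8f11; critic rows 81/92/95 CLEARED)

Tree file 4/4: §6 — THE TARGET 32260 `MaxContactCut.NoSingularSurfaceHuggingTowers` BY NAME from the g13 residual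
`NoNearLineTowers`, the ports and the two CJS engines (`noSingularSurfaceHuggingTowers_of_g13`); necessity port-free
(`noNearLineTowers_of_item`); and up the tree to 31570 / 30253 through the landed `MaxContactCutSurfaceShadow` kernels —
VERBATIM, plus primed variants with leaf #17′ `NoCornerTowers` DISCHARGED (`MaxContactCutCornerTowers.noCornerTowers`).
(Sources: CossartJannsenSaito2020 Cor. 6.37, Thm. 6.40.)
-/

open CategoryTheory AlgebraicGeometry
open Literature.RingTheory.HilbertSamuel
open Literature.AlgebraicGeometry.Resolution
open Literature.AlgebraicGeometry.CossartJannsenSaito2020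
open Summit.ResolutionOfSingularities.ResolutionOfSingularities.Theses
open Summit.ResolutionOfSingularities.ResolutionOfSingularities.Theorems
open WeakOrderReduction ForcedTowerClasses DivergentTowerClasses MonomialTowerClasses
open HugDimensionClasses HugDimensionKernels SurfaceShadowClasses SurfaceShadowKernels

namespace Summit.ResolutionOfSingularities.ResolutionOfSingularities.Theorems.NearPointCut

/-- **THE TARGET 32260 `MaxContactCut.NoSingularSurfaceHuggingTowers` BY NAME from the g13 residual, the ports and
the two CJS engines.** (Sources: CossartJannsenSaito2020, Cor. 6.37, Thm. 6.40.) -/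
theorem noSingularSurfaceHuggingTowers_of_g13 (hR : RealisationAll) (hL : LineagePortAll)
    (h640 : KeyTheorem640_char.{0}) (h637 : Corollary637_char.{0}) (hA : DirOneAdapter) (hRs : Restart)
    (hI : IsolationPortAll) (hN : NoNearLineTowers) : MaxContactCut.NoSingularSurfaceHuggingTowers :=
  fun n hn => singularSurface_of_g13 (hR n hn) (hL n hn) h640 h637 hA hRs (hI n hn) (hN n hn)

/-- Necessity, port-free: 32260 implies the g13 residual. [folklore] -/
theorem noNearLineTowers_of_item (h : MaxContactCut.NoSingularSurfaceHuggingTowers) : NoNearLineTowers :=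
  fun n hn => (pieces_of_singularSurface (h n hn)).2.2.1

/-- **32203 `MaxContactCut.NoSurfaceHuggingTowers` BY NAME** (tree kernel `surfaceLeaf_of_surfaceLaw` + g13).
[folklore] -/
theorem noSurfaceHuggingTowers_of_g13 (hSL : MaxContactCut.SurfaceLawAll) (hR : RealisationAll) (hL : LineagePortAll)
    (h640 : KeyTheorem640_char.{0}) (h637 : Corollary637_char.{0}) (hA : DirOneAdapter) (hRs : Restart)
    (hI : IsolationPortAll) (hN : NoNearLineTowers) : MaxContactCut.NoSurfaceHuggingTowers :=
  fun n hn => surfaceLeaf_of_surfaceLaw (hSL n hn)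
    (noSingularSurfaceHuggingTowers_of_g13 hR hL h640 h637 hA hRs hI hN n hn)

/-- **31570 `MaxContactCut.NoHuggingTowers` BY NAME** (tree kernel `MaxContactCutSurfaceShadow.noHuggingTowers_of_g11`
with its singular-surface hypothesis discharged by g13). [folklore] -/
theorem noHuggingTowers_of_g13 (hM : MaxContactCut.MonomialCornerAll) (hK : NoCornerTowers)
    (hC : MaxContactCut.CurveLawAll) (hSL : MaxContactCut.SurfaceLawAll)
    (hH : MaxContactCut.NoHypersurfaceHuggingTowers) (hR : RealisationAll) (hL : LineagePortAll)
    (h640 : KeyTheorem640_char.{0}) (h637 : Corollary637_char.{0}) (hA : DirOneAdapter) (hRs : Restart)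
    (hI : IsolationPortAll) (hN : NoNearLineTowers) : MaxContactCut.NoHuggingTowers :=
  MaxContactCutSurfaceShadow.noHuggingTowers_of_g11 hM hK hC hSL
    (noSingularSurfaceHuggingTowers_of_g13 hR hL h640 h637 hA hRs hI hN) hH

/-- **30253 `MaxContactCut.NoForcedTowers` BY NAME** (tree kernel `MaxContactCutSurfaceShadow.noForcedTowers_of_g11`).
[folklore] -/
theorem noForcedTowers_of_g13 (hNF : MaxContactCut.CornerNormalFormAll) (hM : MaxContactCut.MonomialCornerAll)
    (hK : NoCornerTowers) (hC : MaxContactCut.CurveLawAll) (hSL : MaxContactCut.SurfaceLawAll)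
    (hH : MaxContactCut.NoHypersurfaceHuggingTowers) (hR : RealisationAll) (hL : LineagePortAll)
    (h640 : KeyTheorem640_char.{0}) (h637 : Corollary637_char.{0}) (hA : DirOneAdapter) (hRs : Restart)
    (hI : IsolationPortAll) (hN : NoNearLineTowers) : MaxContactCut.NoForcedTowers :=
  MaxContactCutSurfaceShadow.noForcedTowers_of_g11 hNF hM hK hC hSL
    (noSingularSurfaceHuggingTowers_of_g13 hR hL h640 h637 hA hRs hI hN) hH

/-- 31570 with the corner hypothesis DISCHARGED BY NAME: `NoCornerTowers` is the tree's
`CornerTowerDynamics.noCornerTowers_tree` (landed 2026-08-30; lens-3 g12 rev 3 / lens-5 g13). [folklore] -/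
theorem noHuggingTowers_of_g13' (hM : MaxContactCut.MonomialCornerAll) (hC : MaxContactCut.CurveLawAll)
    (hSL : MaxContactCut.SurfaceLawAll) (hH : MaxContactCut.NoHypersurfaceHuggingTowers) (hR : RealisationAll)
    (hL : LineagePortAll) (h640 : KeyTheorem640_char.{0}) (h637 : Corollary637_char.{0}) (hA : DirOneAdapter)
    (hRs : Restart) (hI : IsolationPortAll) (hN : NoNearLineTowers) : MaxContactCut.NoHuggingTowers :=
  noHuggingTowers_of_g13 hM CornerTowerDynamics.noCornerTowers_tree hC hSL hH hR hL h640 h637 hA hRs hI hN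

/-- 30253 with the corner hypothesis DISCHARGED BY NAME (`CornerTowerDynamics.noCornerTowers_tree`). [folklore] -/
theorem noForcedTowers_of_g13' (hNF : MaxContactCut.CornerNormalFormAll) (hM : MaxContactCut.MonomialCornerAll)
    (hC : MaxContactCut.CurveLawAll) (hSL : MaxContactCut.SurfaceLawAll) (hH : MaxContactCut.NoHypersurfaceHuggingTowers)
    (hR : RealisationAll) (hL : LineagePortAll) (h640 : KeyTheorem640_char.{0}) (h637 : Corollary637_char.{0})
    (hA : DirOneAdapter) (hRs : Restart) (hI : IsolationPortAll) (hN : NoNearLineTowers) : MaxContactCut.NoForcedTowers :=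
  noForcedTowers_of_g13 hNF hM CornerTowerDynamics.noCornerTowers_tree hC hSL hH hR hL h640 h637 hA hRs hI hN

end Summit.ResolutionOfSingularities.ResolutionOfSingularities.Theorems.NearPointCut
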